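import Mathlib

/-!
# The `sinh`-weight constant `s(a)` (solo-informed, session 24; sharpest §2e (D12)(iii), C204)

For a test function `g` supported in `[-a, a]` and `0 ≤ η`, the off-line defect weight satisfies
`∫ g(x)² sinh(ηx)² dx ≤ sinh(ηa)² ∫ g(x)² dx`; with `η = 1/2` (the edge of the critical strip) this is
the constant `s(a) = sinh²(a/2)` in the zero-side threshold `λ/(1-λ) > κ s(a)/c₁` of (D12)(iii).
Pointwise: `|sinh(ηx)| ≤ sinh(ηa)` for `|x| ≤ a`.
-/

namespace Summit.RiemannHypothesis.RiemannHypothesis.Theorems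

open MeasureTheory

/-- `|sinh (η x)| ≤ sinh (η a)` for `|x| ≤ a` and `0 ≤ η`. -/
theorem abs_sinh_mul_le {η x a : ℝ} (hη : 0 ≤ η) (hx : |x| ≤ a) :
    |Real.sinh (η * x)| ≤ Real.sinh (η * a) := by
  have hxa : x ≤ a := (le_abs_self x).trans hx
  have hxa' : -x ≤ a := (neg_le_abs x).trans hx
  rcases le_or_gt 0 x with h0 | h0
  · have hs : 0 ≤ Real.sinh (η * x) := Real.sinh_nonneg_iff.2 (mul_nonneg hη h0)
    rw [abs_of_nonneg hs]
    exact Real.sinh_le_sinh.2 (mul_le_mul_of_nonneg_left hxa hη)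
  · have hs : Real.sinh (η * x) ≤ 0 := Real.sinh_nonpos_iff.2 (mul_nonpos_of_nonneg_of_nonpos hη h0.le)
    rw [abs_of_nonpos hs, ← Real.sinh_neg, ← mul_neg]
    exact Real.sinh_le_sinh.2 (mul_le_mul_of_nonneg_left hxa' hη)

/-- Pointwise square form: `g(x)² sinh(ηx)² ≤ sinh(ηa)² g(x)²` whenever `g` vanishes off `[-a,a]`. -/
theorem sq_mul_sinh_sq_le {g : ℝ → ℝ} {η a : ℝ} (hη : 0 ≤ η)
    (hsupp : ∀ x, a < |x| → g x = 0) (x : ℝ) :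
    g x ^ 2 * Real.sinh (η * x) ^ 2 ≤ Real.sinh (η * a) ^ 2 * g x ^ 2 := by
  rcases le_or_gt (|x|) a with hx | hx
  · have h := abs_sinh_mul_le hη hx
    have hsq : Real.sinh (η * x) ^ 2 ≤ Real.sinh (η * a) ^ 2 := by
      have ha : 0 ≤ Real.sinh (η * a) :=
        Real.sinh_nonneg_iff.2 (mul_nonneg hη ((abs_nonneg x).trans hx))
      exact sq_le_sq.2 (by rwa [abs_of_nonneg ha])
    calc g x ^ 2 * Real.sinh (η * x) ^ 2 ≤ g x ^ 2 * Real.sinh (η * a) ^ 2 :=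
          mul_le_mul_of_nonneg_left hsq (sq_nonneg _)
      _ = Real.sinh (η * a) ^ 2 * g x ^ 2 := by ring
  · simp [hsupp x hx]

/-- THE `s(a)` BOUND: for `g` vanishing off `[-a, a]` with `g²` integrable and `0 ≤ η`,
`∫ g(x)² sinh(ηx)² dx ≤ sinh(ηa)² · ∫ g(x)² dx`. -/
theorem integral_sq_mul_sinh_sq_le {g : ℝ → ℝ} {η a : ℝ} (hη : 0 ≤ η)
    (hsupp : ∀ x, a < |x| → g x = 0) (hint : Integrable (fun x => g x ^ 2)) :
    ∫ x, g x ^ 2 * Real.sinh (η * x) ^ 2 ≤ Real.sinh (η * a) ^ 2 * ∫ x, g x ^ 2 := by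
  rw [← integral_const_mul]
  refine integral_mono_of_nonneg (Filter.Eventually.of_forall fun x => by positivity)
    (hint.const_mul _) (Filter.Eventually.of_forall fun x => sq_mul_sinh_sq_le hη hsupp x)

/-- The (D12)(iii) instance `η = 1/2`: `∫ g² sinh(x/2)² ≤ sinh(a/2)² ∫ g²`, i.e. `s(a) = sinh²(a/2)`. -/
theorem integral_sq_mul_sinh_half_sq_le {g : ℝ → ℝ} {a : ℝ}
    (hsupp : ∀ x, a < |x| → g x = 0) (hint : Integrable (fun x => g x ^ 2)) :
    ∫ x, g x ^ 2 * Real.sinh (x / 2) ^ 2 ≤ Real.sinh (a / 2) ^ 2 * ∫ x, g x ^ 2 := by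
  have h := integral_sq_mul_sinh_sq_le (η := 1 / 2) (by norm_num) hsupp hint
  simp only [one_div, inv_mul_eq_div] at h
  exact h

end Summit.RiemannHypothesis.RiemannHypothesis.Theorems
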